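import Summits.FinalStateConjecture.FinalStateConjecture.Theses.StarvedNecks
import Literature.Geometry.Lorentzian.KerrData
import Summits.FinalStateConjecture.FinalStateConjecture.Theorems.StarvedNecksHonestFixedRadiusSettlingStubEntryBookkeeping
import Summits.FinalStateConjecture.FinalStateConjecture.Theorems.StarvedNecksHonestFixedRadiusSettlingStubFlatZoneSojourn
import Summits.FinalStateConjecture.FinalStateConjecture.Theorems.StarvedNecksHonestFixedRadiusSettlingStubFarExit

/-!
# Line `sojourn-needs-only-one-over-delta` — skeleton for crux `StarvedNecks.HonestFixedRadiusSettling`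
(crux item stmt-FinalStateConjecture-13550; crux-plan by
planner-cruxplan-stmt-FinalStateConjecture-13550-sojourn-needs-only-o-0, 2026-08-16; line card
`Lines/sojourn-needs-only-one-over-delta.md`).

THE LINE. `G = HonestFixedRadiusSettling` is the only item of route StarvedNecks carrying Christodoulou
genericity, and it carries weak cosmic censorship (`HasCompleteNullInfinity`, sojourn form) INSIDE the generic
property (Disproof §3 `wcc_of_crux`). This line discharges that conjunct POINTWISE on KERR-ENDED data whose
flat chart is, far out, the exact Boyer–Lindquist-time / Kerr–Schild-space chart of the Kerr end
(`OneAtlasAtInfinity`, the answer to the triage ×3 "frame pinning" objection: the entry normalisation of a far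
ray into the certified flat zone is then EXACTLY its Kerr–Killing normalisation, no rigidity lemma is needed):

  `G ⇐ stub_core` (generic: MGHD + honest `C⁴` fixed-radius settling + one atlas at infinity, NO `𝓘⁺` clause)
     `+ Cert` (deterministic: one atlas at infinity + the structure's `deviationCk (flat) k τ → 0` ⇒ complete `𝓘⁺`),
  `Cert ⇐ stub_farExit` (exact Kerr transport of normalised far rays up to their exit from the exact flat zone,
     or completeness if they never exit) `+ stub_entryBookkeeping` (causal membership in `J⁺(ι B♯)` from the
     exit on, and tube clearance of a coordinate cone of height `T`) `+ stub_flatZoneSojourn` (THE LEVER: in a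
     flat chart with rate-free `C¹` deviation `≤ δ` a null geodesic entering with chart rate `≤ L` survives affine
     time `≥ (1 − e^{−CδT})/(CδL)` — one-sided Grönwall read backwards; its real-analysis core
     `affineSojournLowerBound` is PROVED below).

COMPOSITION (kernel-checked, sorry-free outside the four `stub_*`): `cert_of : FarExit → EntryBookkeeping →
FlatZoneSojourn → Cert` (choose `δ = min δ₀ (1/(2CLs))`, `T = 1/(Cδ)`, late entry after the deviation is
`≤ δ`, sojourn `≥ volume [s₀, s₀ + (1−e⁻¹)/(CδL)] ≥ s`), `crux_of_core_of_cert` (genericity is monotone in the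
property), and THE SKELETON THEOREM `HonestFixedRadiusSettling_of : HonestFixedRadiusSettling` (audited by name).

DISPROOF USED (`Cruxes/HonestFixedRadiusSettling/Disproof.lean`, cdisprove cycle 1, NO KILL, no
`_false_without_` theorem): §3 `wcc_of_crux` — honoured: WCC is not assumed anywhere; a WCC failure now refutes
`stub_core` (no honest flat chart with one atlas at infinity exists to the future of a Cauchy horizon, triage
r1-2/r1-3 volume-growth argument), which is where the physics is; §6 `settlesAt_minkowski` — the `M = 0`
instance: `kerrBL 0 a = η` (`kerrBL_zero_mass` below), so the identity flat chart of Minkowski space has one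
atlas at infinity and `Cert` returns `hasCompleteNullInfinity_𝒟₀` through the first disjunct of `FarExit`;
§4 `honestFar_iff_of_N_eq_zero` — consistent (no hole clause is used by `Cert`); §1 kill shape — not engaged.
No landed `Theorems/HonestFixedRadiusSettling/Negative/*` lemma exists (2026-08-16); `ledger negatives` lists
one refuted statement of the summit (`UniformPhotonSphereChannels`, photon-sphere channels) — unrelated to
every stub here.

STATUS (line lead, after wave 1, 2026-08-16T15:42Z): stub_farExit / stub_entryBookkeeping / stub_flatZoneSojourn LANDED and
assembled (`Theorems/StarvedNecksHonestFixedRadiusSettlingCert.lean`, p111091); the crux is REDUCED to the one remaining registered stub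
`stub_core` (open-problem core) by `honestFixedRadiusSettling_of_core`. See §3.

ANTI-VACUITY (evidence file `Lines/sojourn_needs_only_one_over_delta_sanity.lean`, sorry-free, standard axioms;
it imports `Disproof.lean` for `𝒟₀, d₀`, which this skeleton deliberately does not):
`oneAtlasAtInfinity_minkowski : OneAtlasAtInfinity 𝒟₀ d₀ 0 0 0 φ₀ (fun _ ↦ 1) B₂ 1` — every clause of the
one-atlas predicate (verbatim copy) holds at the Minkowski development of the trivial data with the identity
flat chart, `φ₀` the inclusion `Kerr.slice 0 0 ↪ Minkowski.slice`, `R♯ ≡ 1`, `B♯` the closed `2`-ball, `κ = 1`.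
-/

noncomputable section

set_option linter.dupNamespace false
set_option linter.unusedVariables false

open Literature.Geometry.Lorentzian
open scoped Manifold ContDiff ENNReal Topology
open Filter Set MeasureTheory Topology

namespace Summit.FinalStateConjecture.FinalStateConjecture.Cruxes.HonestFixedRadiusSettling.SojournNeedsOnlyOneOverDelta

open Summit.FinalStateConjecture.FinalStateConjecture.Theses.StarvedNecks (HonestFixedRadiusSettling)

/-! ## §0 Named copies of the crux's let-bound predicates (verbatim `Disproof.HonestCore/HonestFar`) -/

/-- `HonestCore d R₀` — verbatim the let-bound `Hc` of the crux (C1 sub-extremal holes, `100 Mᵢ ≤ R₀`,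
orthochronous boosts; C2 anchoring at every radius `≥ R₀`; C3 relatively closed late tube portions; C4
future-oriented flat chart). -/
def HonestCore (𝓢 : Spacetime.{0} 4) (O : Set 𝓢.carrier) (k : ℕ) (d : FinalStateDecomposition 𝓢 O k)
    (R₀ : ℝ) : Prop :=
  let B := d.background; let t := fun i ↦ (B i).time; let r := fun i ↦ (B i).radius; let Ψ := d.chart;
  (∀ i, Kerr.IsSubextremal (d.mass i) (d.spin i) ∧ 100 * d.mass i ≤ R₀ ∧
      0 < ((d.motion i).1 : E4 ≃L[ℝ] E4) (E4.basisVector 0) 0) ∧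
  (∀ i (ϱ τ₂ : ℝ), R₀ ≤ ϱ → d.τ₀ < τ₂ →
      Ψ i '' {x | d.τ₀ < t i x.1 ∧ t i x.1 < τ₂ ∧ r i x.1 < ϱ} ⊆
        𝓢.metric.causalPast 𝓢.timeOrientation (Ψ i '' (B i).truncTimeSlab ϱ τ₂)) ∧
  (∀ i (τ' : ℝ) (ϱ : ℝ → ℝ), Continuous ϱ → d.τ₀ < τ' →
      let A := Ψ i '' {x | τ' ≤ t i x.1 ∧ r i x.1 ≤ ϱ (t i x.1)}; closure A ∩ O ⊆ A) ∧
  (∀ y : d.flatDomain, d.τ₀ < y.1 0 →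
      𝓢.timeOrientation.IsFutureDirected (mfderiv 𝓘(ℝ, E4) (𝓡 4) d.flatChart y (E4.basisVector 0)))

/-- `HonestFar d R₀` — verbatim the let-bound `Hf` of the crux (F1 flat-late points below later flat slabs;
F2 closures of far flat slabs are flat points; F3 each hole chart eventually `C⁰`-close to its boosted Kerr on
its own Voronoi cell beyond `R₀`). -/
def HonestFar (𝓢 : Spacetime.{0} 4) (O : Set 𝓢.carrier) (k : ℕ) (d : FinalStateDecomposition 𝓢 O k)
    (R₀ : ℝ) : Prop :=
  let B := d.background; let t := fun i ↦ (B i).time; let r := fun i ↦ (B i).radius; let Φ := d.flatChart;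
  (∀ τ₂ : ℝ, d.τ₀ < τ₂ → Φ '' {y | d.τ₀ < y.1 0 ∧ y.1 0 < τ₂} ⊆
      𝓢.metric.causalPast 𝓢.timeOrientation (Φ '' (Minkowski.backgroundOn d.flatDomain).timeSlab τ₂)) ∧
  (∀ τ' : ℝ, d.τ₀ < τ' →
      closure (Φ '' {y | τ' ≤ y.1 0 ∧ ∀ i, d.excision i (y.1 0) + 1 ≤ r i y.1}) ⊆ Φ '' {y | τ' ≤ y.1 0}) ∧
  (∀ i, ∃ T : ℝ, supCkENorm (Subtype.val '' {x : (B i).domain | T ≤ t i x.1 ∧ R₀ ≤ r i x.1 ∧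
      ∀ j, j ≠ i → r i x.1 ≤ r j x.1}) 0 (𝓢.deviationExtend (B i) (d.chart i)) ≤
        ENNReal.ofReal (1 / (10 * ‖(((d.motion i).1 : E4 ≃L[ℝ] E4) : E4 →L[ℝ] E4)‖ ^ 2)))

/-! ## §1 The exact end in Boyer–Lindquist time: one atlas at infinity -/

/-- The hard-coded BENT HEIGHT `T_{M,a}(r)` of route SwallowTheDatum, VERBATIM (so that Kerr-ENDED data here and
Kerr-SHIELDED data there share one slice recipe): `≡ 0` for `r ≤ 4M`, `Real.smoothTransition` on `[4M, 8M]`,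
and for `r ≥ 8M` the Boyer–Lindquist height `F(r) − F(4M)`, `F' = 2Mr/Δ`, i.e. `{t* = t + T(r)} = {t_BL = t}`
there. -/
def blHeight (M a : ℝ) (r : ℝ) : ℝ :=
  Real.smoothTransition (r / (4 * M) - 1) *
    ((M / Real.sqrt (M ^ 2 - a ^ 2)) *
        (Kerr.rPlus M a * Real.log (r - Kerr.rPlus M a) - Kerr.rMinus M a * Real.log (r - Kerr.rMinus M a)) -
      (M / Real.sqrt (M ^ 2 - a ^ 2)) *
        (Kerr.rPlus M a * Real.log (4 * M - Kerr.rPlus M a) - Kerr.rMinus M a * Real.log (4 * M - Kerr.rMinus M a)))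

/-- The chart map `(t, x) ↦ (t* = t + T_{M,a}(r(a, x)), x)` from Boyer–Lindquist-type time over Kerr–Schild space
into the ingoing Kerr–Schild chart. Its `t = 0` leaf is the bent slice `ψ` of SwallowTheDatum / of a Kerr end. -/
def blToKS (M a : ℝ) (y : E4) : E4 :=
  E4.ofTimeSpace (y 0 + blHeight M a (Kerr.radius a (E4.ofTimeSpace 0 (E4.spatial y)))) (E4.spatial y)

/-- The EXACT KERR METRIC COMPONENTS in the `(t_BL-type, x_KS)` chart: the pullback `blToKS^* g_{M,a}` of the
Kerr–Schild form. Stationary (`∂₀` is Killing: the components do not depend on `y⁰`), `= η + O(M/r)` with all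
derivatives, and `= η` exactly for `M = 0` (`kerrBL_zero_mass`). -/
def kerrBL (M a : ℝ) (y : E4) : E4 →L[ℝ] E4 →L[ℝ] ℝ :=
  (Kerr.bilin M a (blToKS M a y)).bilinearComp (fderiv ℝ (blToKS M a) y) (fderiv ℝ (blToKS M a) y)

section OneAtlas

variable {X : Type} [TopologicalSpace X] [ChartedSpace E3 X] [IsManifold (𝓡 3) ∞ X] [ConnectedSpace X]
  {D : InitialDataSet (𝓡 3) X}

/-- **ONE ATLAS AT INFINITY** for a final-state decomposition `d` of a development `𝒟` of `D`, with a Kerr end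
`(M, a)` attached along `φ : Kerr.slice a r₁ → X`, exact flat zone `Z = {y | −1 < y⁰, R♯(y⁰) < |y⃗|}` of inner
radius profile `R♯ = Rs`, core `B♯ = Bs ⊆ X` and tube-separation rate `κ`. Clauses (all satisfiable on a
Kerr-ended MGHD by `Φ := χ ∘ blToKS` on `Z`, `χ` the isometric embedding of the exact Kerr region
`D⁺(ι φ(far))` — SwallowTheDatum's `SubdataDevelopmentsEmbed` — with `R♯` = an outgoing-cone profile):
* `IsCompact Bs`, `0 < κ`; `0 ≤ M`, `|a| ≤ M`; `R♯` continuous, `16M + |a| + 1 ≤ R♯`, and `R♯` grows at slope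
  `≤ 2` (`R♯ t' ≤ R♯ t + 2 (t' − t)` for `0 ≤ t ≤ t'`);
* ZONE: `Z ⊆ flatDomain`; EXACT: on `Z` the flat chart's pulled-back metric IS `kerrBL M a` (deviation from `η`
  equals `kerrBL − η`); ORIENTED: `Φ_* ∂₀` is future-directed on `Z`; INJECTIVE: `Φ` is injective on
  `{y⁰ ≥ 0} ∩ flatDomain`;
* ATTACHED: `φ` is a smooth open embedding whose far sets `φ {ρ < ‖x‖}` have compact complements, and
  `Φ(0, x) = ι(φ x)` for `‖x‖ > R♯ 0` (the `t = 0` leaf of `Z` is the far part of the data hypersurface);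
* COVER: `J⁺(ι X) ⊆ J⁺(ι Bs) ∪ Φ(Z ∩ {y⁰ ≥ 0})` (outside the exact flat zone everything to the future of the
  data is in the future of the compact core);
* SEPARATED: from `τ₀` on, every point of a flat tube `{rᵢ(Λᵢ⁻¹(y − cᵢ)) ≤ ρᵢ(y⁰)}` has `|y⃗| + κ y⁰ ≤ R♯(y⁰)`. -/
def OneAtlasAtInfinity (𝒟 : VacuumCauchyDevelopment D) {O : Set 𝒟.carrier} {k : ℕ}
    (d : FinalStateDecomposition 𝒟.toSpacetime O k) (M a r₁ : ℝ) (φ : Kerr.slice a r₁ → X)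
    (Rs : ℝ → ℝ) (Bs : Set X) (κ : ℝ) : Prop :=
  IsCompact Bs ∧ 0 < κ ∧ 0 ≤ M ∧ |a| ≤ M ∧ Continuous Rs ∧ (∀ t, 16 * M + |a| + 1 ≤ Rs t) ∧
  (∀ t t' : ℝ, 0 ≤ t → t ≤ t' → Rs t' ≤ Rs t + 2 * (t' - t)) ∧
  -- ZONE
  ({y : E4 | -1 < y 0 ∧ Rs (y 0) < E4.spatialNorm y} ⊆ (d.flatDomain : Set E4)) ∧
  -- EXACT
  (∀ y : d.flatDomain, -1 < y.1 0 → Rs (y.1 0) < E4.spatialNorm y.1 →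
    𝒟.toSpacetime.deviation (Minkowski.backgroundOn d.flatDomain) d.flatChart y =
      kerrBL M a y.1 - Minkowski.bilin) ∧
  -- ORIENTED
  (∀ y : d.flatDomain, -1 < y.1 0 → Rs (y.1 0) < E4.spatialNorm y.1 →
    𝒟.timeOrientation.IsFutureDirected (mfderiv 𝓘(ℝ, E4) (𝓡 4) d.flatChart y (E4.basisVector 0))) ∧
  -- INJECTIVE
  Set.InjOn d.flatChart {y : d.flatDomain | 0 ≤ y.1 0} ∧
  -- ATTACHED
  IsOpenEmbedding φ ∧ ContMDiff 𝓘(ℝ, E3) (𝓡 3) ∞ φ ∧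
  (∀ ρ : ℝ, IsCompact (φ '' {x : Kerr.slice a r₁ | ρ < ‖(x : E3)‖})ᶜ) ∧
  (∀ (x : Kerr.slice a r₁) (hx : E4.ofTimeSpace 0 (x : E3) ∈ d.flatDomain), Rs 0 < ‖(x : E3)‖ →
    d.flatChart ⟨E4.ofTimeSpace 0 (x : E3), hx⟩ = 𝒟.embed (φ x)) ∧
  -- COVER
  (𝒟.metric.causalFuture 𝒟.timeOrientation (range 𝒟.embed) ⊆
    𝒟.metric.causalFuture 𝒟.timeOrientation (𝒟.embed '' Bs) ∪
      d.flatChart '' {y : d.flatDomain | 0 ≤ y.1 0 ∧ Rs (y.1 0) < E4.spatialNorm y.1}) ∧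
  -- SEPARATED
  (∀ (i : Fin d.N) (z : E4), d.τ₀ ≤ z 0 →
    Kerr.radius (d.spin i) (poincareInv (d.motion i).1 (d.motion i).2 z) ≤ d.excision i (z 0) →
      E4.spatialNorm z + κ * z 0 ≤ Rs (z 0))

/-- EXIT EVENT of a ray `γ` (affine domain `dom`) from the exact flat zone of inner radius profile `Rs`: at the
parameter `s ≥ 0`, `s ∈ dom`, the ray sits at the flat-charted LATE point `Φ y` ON the inner boundary
`|y⃗| = R♯(y⁰)`, `y⁰ ≥ 0`, with velocity `Φ_* w`, null, forward in chart time and with CHART RATE `w⁰ ≤ L`. -/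
def ExitEvent (𝒟 : VacuumCauchyDevelopment D) {O : Set 𝒟.carrier} {k : ℕ}
    (d : FinalStateDecomposition 𝒟.toSpacetime O k) (Rs : ℝ → ℝ) (L : ℝ) (γ : ℝ → 𝒟.carrier) (dom : Set ℝ)
    (s : ℝ) (y : d.flatDomain) (w : E4) : Prop :=
  s ∈ dom ∧ 0 ≤ s ∧ γ s = d.flatChart y ∧ d.τ₀ < y.1 0 ∧ 0 ≤ y.1 0 ∧ E4.spatialNorm y.1 = Rs (y.1 0) ∧
    velocity (𝓡 4) γ s = mfderiv 𝓘(ℝ, E4) (𝓡 4) d.flatChart y w ∧ 𝒟.metric.IsNull (velocity (𝓡 4) γ s) ∧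
      0 < w 0 ∧ w 0 ≤ L

/-- The COORDINATE CONE of height `T` over the flat point `y`: chart times `y⁰ ≤ z⁰ ≤ y⁰ + T`, spatial distance
from `y⃗` at most `2 (z⁰ − y⁰) + 1` (slope `2 >` the coordinate light speed `≤ 1 + 3δ` of a `δ`-flat chart). -/
def coordCone (y : E4) (T : ℝ) : Set E4 :=
  {z : E4 | y 0 ≤ z 0 ∧ z 0 ≤ y 0 + T ∧ ‖E4.spatial z - E4.spatial y‖ ≤ 2 * (z 0 - y 0) + 1}

/-- The pointwise property `Q D` whose genericity is `stub_core`: an MGHD exists, and every MGHD carries an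
honest `C⁴` fixed-radius decomposition of its self-determined exterior (VERBATIM the crux's clauses) which has,
in addition, ONE ATLAS AT INFINITY for some Kerr end — and NO `𝓘⁺` clause. -/
def OneAtlasSettling (D : InitialDataSet (𝓡 3) X) : Prop :=
  (∃ 𝒟 : VacuumCauchyDevelopment D, 𝒟.IsMaximal) ∧
    ∀ 𝒟 : VacuumCauchyDevelopment D, 𝒟.IsMaximal →
      ∃ (O : Set 𝒟.carrier) (d : FinalStateDecomposition 𝒟.toSpacetime O 4) (R₀ : ℝ),
        O = exteriorOf 𝒟.toCauchyDevelopment d.charted ∧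
          HonestCore 𝒟.toSpacetime O 4 d R₀ ∧ HonestFar 𝒟.toSpacetime O 4 d R₀ ∧
            ∃ (M a r₁ : ℝ) (φ : Kerr.slice a r₁ → X) (Rs : ℝ → ℝ) (Bs : Set X) (κ : ℝ),
              OneAtlasAtInfinity 𝒟 d M a r₁ φ Rs Bs κ

end OneAtlas

/-! ## §2 The statements of the line -/

/-- **CORE** (generic; the open-problem part = `G` with the `𝓘⁺` conjunct REPLACED by one atlas at infinity):
for every admissible `3`-manifold `X`, `OneAtlasSettling` is Christodoulou-generic (codimension `1`) in
`admissibleVacuumData X`. Since every non-Kerr-ended datum is exceptional, the witness curves are necessarily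
RECEDING FAR-FIELD SURGERIES onto exact Kerr ends (sibling card far-field-surgery: Mao–Oh–Tao arXiv:2308.13031
Thm 1.7 at `s = 2`, Corvino–Schoen; joint smoothness at `c = 0` by `IsSmoothDataFamily.of_eventuallyEq_zero`),
along which (cone selection off a tame exceptional trace) every member `c ≠ 0` settles honestly in `C⁴` at
fixed radius with its flat chart EQUAL to `χ ∘ blToKS` on the exact zone. WHY IT MIGHT FAIL: it is most of the
final state conjecture on the Kerr-ended class (capture, `N < ∞`, sub-extremality, honest `C⁴` charts); a
generic cascade of small holes, wandering velocities or extremal limits refute it exactly as they refute `G`;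
what it does NOT contain any more is weak cosmic censorship as a separately-argued clause. -/
def KerrEndedHonestSettlingGeneric : Prop :=
  ∀ (X : Type) [TopologicalSpace X] [ChartedSpace E3 X] [IsManifold (𝓡 3) ∞ X] [T2Space X]
    [SecondCountableTopology X] [ConnectedSpace X],
    InitialDataSet.IsChristodoulouGeneric (admissibleVacuumData X) OneAtlasSettling 1

/-- **FAR EXIT** (exact Kerr transport; size L). One atlas at infinity gives a chart rate bound `L > 0` such that
for every lateness demand `τ`, beyond a compact `B₁ ⊆ X`, every normalised future null ray is future complete
OR exits the exact flat zone through its inner boundary at a flat-charted late point of chart time `≥ τ` with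
null velocity `Φ_* w`, `0 < w⁰ ≤ L` (`ExitEvent`). MECHANISM: on `Z` the ray is `Φ ∘ z` with `z` a null
geodesic of the stationary metric `kerrBL` (local isometry + uniqueness of geodesics), its Killing energy
`E = −kerrBL(∂₀, ż) ∈ [1/2, 2]` is conserved (`OpensChart.hasDerivAt_momentum_of_isGeodesicOn` with `∂₀ kerrBL
= 0`) and pinned at `t = 0` by `g(γ̇(0), N) = −1` (lapse `→ 1`, shift `→ 0`); `ż⁰ ≤ 2E` on `{r ≥ 16M}`; the exit
time is `≥ (‖x‖ − R♯ 0)/3.2` (coordinate light speed `≤ 1.2`, `R♯` slope `≤ 2`); a ray that never exits stays in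
`{r > 16M + |a| + 1}` with `ż⁰ ≥ E/1.1 > 0` and is complete (ODE continuation), hence so is the maximal `γ`. -/
def FarExit : Prop :=
  ∀ (X : Type) [TopologicalSpace X] [ChartedSpace E3 X] [IsManifold (𝓡 3) ∞ X] [T2Space X]
    [SecondCountableTopology X] [ConnectedSpace X] (D : InitialDataSet (𝓡 3) X)
    (𝒟 : VacuumCauchyDevelopment D) (O : Set 𝒟.carrier) (k : ℕ) (d : FinalStateDecomposition 𝒟.toSpacetime O k)
    (M a r₁ : ℝ) (φ : Kerr.slice a r₁ → X) (Rs : ℝ → ℝ) (Bs : Set X) (κ : ℝ),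
    OneAtlasAtInfinity 𝒟 d M a r₁ φ Rs Bs κ →
    ∀ [𝒟.metric.HasLeviCivita],
    ∃ L : ℝ, 0 < L ∧ ∀ τ : ℝ, ∃ B₁ : Set X, IsCompact B₁ ∧
      ∀ p ∉ B₁, ∀ (γ : ℝ → 𝒟.carrier) (dom : Set ℝ),
        𝒟.metric.IsNormalisedNullRayFrom 𝒟.timeOrientation 𝒟.embed 𝒟.normal p γ dom →
          ¬ BddAbove dom ∨
            ∃ (s : ℝ) (y : d.flatDomain) (w : E4), τ ≤ y.1 0 ∧ ExitEvent 𝒟 d Rs L γ dom s y w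

/-- **ENTRY BOOKKEEPING** (causal plumbing + tube algebra; size M). After an exit event (i) the ray stays in
`J⁺(ι Bs)` for all later parameters — `γ s ∈ J⁺(ι X)` (future null geodesic from `ι p`,
`CausalCurveNullGeodesic`), `γ s ∉ Φ(Z ∩ {y⁰ ≥ 0})` by INJECTIVE (`|y⃗| = R♯(y⁰)` is not `>`), hence
`γ s ∈ J⁺(ι Bs)` by COVER, and `J⁺` is closed under future causal curves (`CausalityPushUp`); (ii) if the exit
is late enough, `(4T + 2)/κ ≤ y⁰`, the coordinate cone of height `T` over the exit point lies in `flatDomain`: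
a cone point inside a flat tube would have `|z⃗| + κ z⁰ ≤ R♯(z⁰) ≤ R♯(y⁰) + 2 (z⁰ − y⁰)` (SEPARATED, slope) yet
`|z⃗| ≥ R♯(y⁰) − 2 (z⁰ − y⁰) − 1`, forcing `κ z⁰ ≤ 4T + 1` — so it is late and outside every tube, and
`setOf_lt_excision_subset_flatDomain` applies. -/
def EntryBookkeeping : Prop :=
  ∀ (X : Type) [TopologicalSpace X] [ChartedSpace E3 X] [IsManifold (𝓡 3) ∞ X] [T2Space X]
    [SecondCountableTopology X] [ConnectedSpace X] (D : InitialDataSet (𝓡 3) X)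
    (𝒟 : VacuumCauchyDevelopment D) (O : Set 𝒟.carrier) (k : ℕ) (d : FinalStateDecomposition 𝒟.toSpacetime O k)
    (M a r₁ : ℝ) (φ : Kerr.slice a r₁ → X) (Rs : ℝ → ℝ) (Bs : Set X) (κ : ℝ),
    OneAtlasAtInfinity 𝒟 d M a r₁ φ Rs Bs κ →
    ∀ [𝒟.metric.HasLeviCivita] (p : X) (γ : ℝ → 𝒟.carrier) (dom : Set ℝ),
      𝒟.metric.IsNormalisedNullRayFrom 𝒟.timeOrientation 𝒟.embed 𝒟.normal p γ dom →
      ∀ (L T s : ℝ) (y : d.flatDomain) (w : E4), ExitEvent 𝒟 d Rs L γ dom s y w → 0 ≤ T →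
        (∀ s' ∈ dom, s ≤ s' → γ s' ∈ 𝒟.metric.causalFuture 𝒟.timeOrientation (𝒟.embed '' Bs)) ∧
        ((4 * T + 2) / κ ≤ y.1 0 → coordCone y.1 T ⊆ (d.flatDomain : Set E4))

/-- **FLAT-ZONE SOJOURN** (THE LEVER; size M). There are `C > 0` and `δ₀ > 0` such that: if a maximal geodesic
`γ` passes at parameter `s` through a late flat-charted point `Φ y` with NULL velocity `Φ_* w`, `0 < w⁰ ≤ L`,
the flat chart's `C¹` deviation from `η` is `≤ δ ≤ δ₀` on every flat slab of chart time in `[y⁰, y⁰ + T]`, and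
the coordinate cone of height `T` over `y` lies in `flatDomain`, then `γ` survives at least affine time
`(1 − e^{−CδT})/(CδL)` after `s`. MECHANISM: the coordinate curve `z = Φ⁻¹ ∘ γ` solves the geodesic equations
of `h = Φ^* g = η + e`, `|e|, |∂e| ≤ δ` (`OpensChartGeodesicODE`); null ⇒ `|ż⃗| ≤ (1 + 3δ) ż⁰`, `|Γ| ≤ C₁ δ` ⇒
`|d log ż⁰ / dz⁰| ≤ C δ` ⇒ `ż⁰ ≤ L e^{Cδ(z⁰ − y⁰)}` ⇒ affine time over chart time `T` is
`≥ ∫₀ᵀ e^{−Cδt} dt / L = (1 − e^{−CδT})/(CδL)` (`affineSojournLowerBound`, PROVED below); the solution stays in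
the cone (slope `≤ 1 + 3δ < 2`), where `Φ` is an isometric open embedding into `𝒟`, so by maximality of `γ` the
whole parameter interval lies in `dom` (if `γ` is red-shifted and never reaches chart time `y⁰ + T`, it stays in
the compact cone for ever and the interval is in `dom` a fortiori). -/
def FlatZoneSojourn : Prop :=
  ∃ C : ℝ, 0 < C ∧ ∃ δ₀ : ℝ, 0 < δ₀ ∧
  ∀ (X : Type) [TopologicalSpace X] [ChartedSpace E3 X] [IsManifold (𝓡 3) ∞ X] [T2Space X]
    [SecondCountableTopology X] [ConnectedSpace X] (D : InitialDataSet (𝓡 3) X)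
    (𝒟 : VacuumCauchyDevelopment D) (O : Set 𝒟.carrier) (k : ℕ) (d : FinalStateDecomposition 𝒟.toSpacetime O k),
    ∀ [𝒟.metric.HasLeviCivita] (γ : ℝ → 𝒟.carrier) (dom : Set ℝ),
      IsMaximalGeodesicOn 𝒟.metric.leviCivita γ dom →
      ∀ (s : ℝ) (y : d.flatDomain) (w : E4) (L δ T : ℝ),
        s ∈ dom → γ s = d.flatChart y → d.τ₀ < y.1 0 →
        velocity (𝓡 4) γ s = mfderiv 𝓘(ℝ, E4) (𝓡 4) d.flatChart y w →
        𝒟.metric.IsNull (velocity (𝓡 4) γ s) → 0 < w 0 → w 0 ≤ L → 0 < δ → δ ≤ δ₀ → 0 ≤ T →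
        (∀ τ' : ℝ, y.1 0 ≤ τ' → τ' ≤ y.1 0 + T →
          𝒟.toSpacetime.deviationCk (Minkowski.backgroundOn d.flatDomain) d.flatChart 1 τ' ≤ ENNReal.ofReal δ) →
        coordCone y.1 T ⊆ (d.flatDomain : Set E4) →
        ∀ s' : ℝ, s ≤ s' → s' ≤ s + (1 - Real.exp (-(C * δ * T))) / (C * δ * L) → s' ∈ dom

/-- **CERT** (deterministic; NOT a stub — derived in `cert_of`): on a development carrying a `C^k` (`k ≥ 1`)
final-state decomposition with one atlas at infinity, future null infinity is complete in the sojourn form. -/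
def Cert : Prop :=
  ∀ (X : Type) [TopologicalSpace X] [ChartedSpace E3 X] [IsManifold (𝓡 3) ∞ X] [T2Space X]
    [SecondCountableTopology X] [ConnectedSpace X] (D : InitialDataSet (𝓡 3) X)
    (𝒟 : VacuumCauchyDevelopment D) (O : Set 𝒟.carrier) (k : ℕ) (d : FinalStateDecomposition 𝒟.toSpacetime O k)
    (M a r₁ : ℝ) (φ : Kerr.slice a r₁ → X) (Rs : ℝ → ℝ) (Bs : Set X) (κ : ℝ),
    1 ≤ k → OneAtlasAtInfinity 𝒟 d M a r₁ φ Rs Bs κ → HasCompleteNullInfinity 𝒟.toCauchyDevelopment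

/-! ## §3 Registered stubs

Reshape v2 (line lead, 2026-08-16): the three DETERMINISTIC stubs are registered in DEF-FREE form — every
line-local definition (`OneAtlasAtInfinity`, `ExitEvent`, `coordCone`, `kerrBL`, `blToKS`, `blHeight`) is
unfolded into `let`-bound abbreviations or explicit clause hypotheses over tree vocabulary only — so that each
stub can be landed as a stand-alone `--supports` file under `Theorems/` without a reviewed vocabulary module.
The named statements `FarExit`, `EntryBookkeeping`, `FlatZoneSojourn` of §2 are then DERIVED from the stubs
(`farExit_of_stub`, `entryBookkeeping_of_stub`, `flatZoneSojourn_of_stub`, sorry-free glue below), and the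
composition of §4 is unchanged. `stub_entryBookkeeping` keeps only the five one-atlas clauses and the six
exit-event clauses its proof consumes (κ > 0, slope ≤ 2, INJECTIVE, COVER, SEPARATED; s ∈ dom, 0 ≤ s,
γ s = Φ y, y late, y⁰ ≥ 0, |y⃗| = R♯(y⁰)). -/

/-- STUB (the open-problem core, shared with the sibling line far-field-surgery; size: open-problem):
see `KerrEndedHonestSettlingGeneric`. -/
theorem stub_core : KerrEndedHonestSettlingGeneric := by
  sorry

/-! LANDED (wave 1, 2026-08-16): the three deterministic registered stubs are PROVED in the tree, with the def-free
signatures of reshape v2 verbatim —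
`Theorems/StarvedNecksHonestFixedRadiusSettlingStubFarExit.lean` (`…Theorems.StarvedNecks.OneOverDelta.stub_farExit`, p105561, + 8 helper
files Energy/Escape/End/Chart/Kinematics/Zone/Transport/Assembly), `…StubEntryBookkeeping.lean` (`stub_entryBookkeeping`, p84922),
`…StubFlatZoneSojourn.lean` (`stub_flatZoneSojourn`, p93773, + ODE p85628, Transport p87144) — and ASSEMBLED in the tree file
`Theorems/StarvedNecksHonestFixedRadiusSettlingCert.lean` (p111091): `hasCompleteNullInfinity_of_oneAtlas` (= `Cert`, def-free) and
`honestFixedRadiusSettling_of_core` (the def-free statement of `stub_core` → the crux). The landed stubs are imported and consumed by the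
glue below; the only `sorry` left in this skeleton is `stub_core`. Minimal equivalent form of the skeleton theorem once `…Cert` is importable:
`theorem HonestFixedRadiusSettling_of : HonestFixedRadiusSettling := Theorems.StarvedNecks.OneOverDelta.honestFixedRadiusSettling_of_core stub_core`
(checked in the lead's probe; kept in the lead's folder as work/HonestFixedRadiusSettling.min.lean). -/

open Summit.FinalStateConjecture.FinalStateConjecture.Theorems.StarvedNecks.OneOverDelta
  (stub_farExit stub_entryBookkeeping stub_flatZoneSojourn)

/-! ## §3b Glue: the named statements of §2 from the def-free registered stubs (sorry-free) -/

/-- `FarExit` from `stub_farExit`: destructure `OneAtlasAtInfinity`, feed the clauses, repackage `ExitEvent`. -/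
theorem farExit_of_stub : FarExit := by
  intro X _ _ _ _ _ _ D 𝒟 O k d M a r₁ φ Rs Bs κ hoai inst
  obtain ⟨h1, h2, h3, h4, h5, h6, h7, h8, h9, h10, h11, h12, h13, h14, h15, h16, h17⟩ := hoai
  obtain ⟨L, hL, hray⟩ := stub_farExit X D 𝒟 O k d M a r₁ φ Rs Bs κ h1 h2 h3 h4 h5 h6 h7 h8 h9 h10 h11 h12
    h13 h14 h15 h16 h17
  refine ⟨L, hL, fun τ ↦ ?_⟩
  obtain ⟨B₁, hB₁, hB⟩ := hray τ
  refine ⟨B₁, hB₁, fun p hp γ dom hγ ↦ ?_⟩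
  rcases hB p hp γ dom hγ with h | ⟨s, y, w, hτ, hev⟩
  · exact Or.inl h
  · exact Or.inr ⟨s, y, w, hτ, hev⟩

/-- `EntryBookkeeping` from `stub_entryBookkeeping`: only κ > 0, slope, INJECTIVE, COVER, SEPARATED and six
exit-event clauses are consumed. -/
theorem entryBookkeeping_of_stub : EntryBookkeeping := by
  intro X _ _ _ _ _ _ D 𝒟 O k d M a r₁ φ Rs Bs κ hoai inst p γ dom hγ L T s y w hexit hT
  obtain ⟨-, h2, -, -, -, -, h7, -, -, -, h11, -, -, -, -, h16, h17⟩ := hoai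
  obtain ⟨hs, hs0, hγs, hlate, hy0, hsph, -, -, -, -⟩ := hexit
  exact stub_entryBookkeeping X D 𝒟 O k d Rs Bs κ h2 h7 h11 h16 h17 p γ dom hγ T s y hs hs0 hγs hlate hy0
    hsph hT

/-- `FlatZoneSojourn` from `stub_flatZoneSojourn` (`coordCone` is unfolded definitionally). -/
theorem flatZoneSojourn_of_stub : FlatZoneSojourn := stub_flatZoneSojourn

/-! ## §4 Kernel-checked compositions -/

/-- `e⁻¹ ≤ 1/2`. -/
theorem exp_neg_one_le_half : Real.exp (-1) ≤ 1 / 2 := by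
  have h2 : (2 : ℝ) ≤ Real.exp 1 := by
    have := Real.add_one_le_exp (1 : ℝ)
    linarith
  rw [Real.exp_neg, one_div]
  exact inv_anti₀ (by norm_num) h2

/-- **CERT from the three deterministic stubs.** Given `s > 0`: `δ := min δ₀ (1/(2CLs))`, a chart time `τδ`
after which the flat `C^k` (hence `C¹`) deviation is `≤ δ`, `T := 1/(Cδ)`, entry demanded later than
`max τδ ((4T+2)/κ)`; a non-complete ray then has an exit event, stays in `J⁺(ι Bs)` afterwards, the cone over
the exit point is in `flatDomain`, and the flat-zone lemma keeps `[s₀, s₀ + (1 − e⁻¹)/(CδL)] ⊆ dom`; that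
interval has Lebesgue measure `≥ (1/2)·2s = s` and lies in `{t ∈ dom | 0 ≤ t ∧ γ t ∈ J⁺(ι Bs)}`. -/
theorem cert_of (hA : FarExit) (hB : EntryBookkeeping) (hZ : FlatZoneSojourn) : Cert := by
  intro X _ _ _ _ _ _ D 𝒟 O k d M a r₁ φ Rs Bs κ hk hoai inst
  obtain ⟨C, hC, δ₀, hδ₀, hZ'⟩ := hZ
  obtain ⟨L, hL, hA'⟩ := hA X D 𝒟 O k d M a r₁ φ Rs Bs κ hoai
  have hBs : IsCompact Bs := hoai.1
  have hκ : 0 < κ := hoai.2.1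
  refine ⟨Bs, hBs, fun s hs ↦ ?_⟩
  -- the deviation size and the chart time budget
  set δ : ℝ := min δ₀ (1 / (2 * C * L * s)) with hδ_def
  have hδ : 0 < δ := lt_min hδ₀ (by positivity)
  have hδle : δ ≤ δ₀ := min_le_left _ _
  have hδle' : δ ≤ 1 / (2 * C * L * s) := min_le_right _ _
  obtain ⟨τδ, hτδ⟩ : ∃ τδ : ℝ, ∀ τ', τδ ≤ τ' →
      𝒟.toSpacetime.deviationCk (Minkowski.backgroundOn d.flatDomain) d.flatChart k τ' ≤ ENNReal.ofReal δ := by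
    have h := (ENNReal.tendsto_nhds_zero.1 d.tendsto_deviationCk_flat) (ENNReal.ofReal δ)
      (ENNReal.ofReal_pos.2 hδ)
    exact Filter.eventually_atTop.1 h
  set T : ℝ := 1 / (C * δ) with hT_def
  have hT : 0 ≤ T := by positivity
  have hCδT : C * δ * T = 1 := by
    rw [hT_def]
    field_simp
  obtain ⟨B₁, hB₁, hray⟩ := hA' (max τδ ((4 * T + 2) / κ))
  refine ⟨B₁, hB₁, fun p hp γ dom hγ ↦ ?_⟩
  rcases hray p hp γ dom hγ with hcomplete | ⟨s₀, y, w, hτy, hexit⟩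
  · exact Or.inl hcomplete
  right
  obtain ⟨hmem, hclear⟩ := hB X D 𝒟 O k d M a r₁ φ Rs Bs κ hoai p γ dom hγ L T s₀ y w hexit hT
  have hclear' : coordCone y.1 T ⊆ (d.flatDomain : Set E4) := hclear (le_trans (le_max_right _ _) hτy)
  obtain ⟨hs₀dom, hs₀, hγy, hlate, hy0, hsph, hvel, hnull, hw0, hwL⟩ := hexit
  have hdev : ∀ τ' : ℝ, y.1 0 ≤ τ' → τ' ≤ y.1 0 + T →
      𝒟.toSpacetime.deviationCk (Minkowski.backgroundOn d.flatDomain) d.flatChart 1 τ' ≤ ENNReal.ofReal δ := by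
    intro τ' h1 _
    exact le_trans (𝒟.toSpacetime.deviationCk_mono (Minkowski.backgroundOn d.flatDomain) d.flatChart hk τ')
      (hτδ τ' (le_trans (le_trans (le_max_left _ _) hτy) h1))
  have hstay := hZ' X D 𝒟 O k d γ dom hγ.isMaximalGeodesicOn s₀ y w L δ T hs₀dom hγy hlate hvel hnull hw0
    hwL hδ hδle hT hdev hclear'
  -- the sojourn bound
  set b : ℝ := (1 - Real.exp (-(C * δ * T))) / (C * δ * L) with hb_def
  have hCδL : 0 < C * δ * L := by positivity
  have hb : s ≤ b := by
    rw [hb_def, le_div_iff₀ hCδL, hCδT]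
    have h1 : s * (C * δ * L) ≤ 1 / 2 := by
      calc s * (C * δ * L) = (s * C * L) * δ := by ring
        _ ≤ (s * C * L) * (1 / (2 * C * L * s)) := by gcongr
        _ = 1 / 2 := by field_simp
    have h2 := exp_neg_one_le_half
    linarith
  calc ENNReal.ofReal s ≤ ENNReal.ofReal b := ENNReal.ofReal_le_ofReal hb
    _ = volume (Icc s₀ (s₀ + b)) := by rw [Real.volume_Icc, add_sub_cancel_left]
    _ ≤ sojournTime γ dom (𝒟.metric.causalFuture 𝒟.timeOrientation (𝒟.embed '' Bs)) := by
      unfold sojournTime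
      exact measure_mono fun t ht ↦
        ⟨hstay t ht.1 ht.2, hs₀.trans ht.1, hmem t (hstay t ht.1 ht.2) ht.1⟩

/-- Christodoulou genericity is monotone in the property (antitone in the exceptional set) — the 5-line lemma of
`Disproof.isChristodoulouGeneric_mono` / of the route's `closes`, re-proved here to keep the skeleton import-light. -/
theorem isChristodoulouGeneric_mono {X : Type} [TopologicalSpace X] [ChartedSpace E3 X] [IsManifold (𝓡 3) ∞ X]
    {𝓓 : Set (InitialDataSet (𝓡 3) X)} {P Q : InitialDataSet (𝓡 3) X → Prop}
    (hPQ : ∀ d ∈ 𝓓, P d → Q d) {m : ℕ} (hP : InitialDataSet.IsChristodoulouGeneric 𝓓 P m) :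
    InitialDataSet.IsChristodoulouGeneric 𝓓 Q m := by
  intro d hd
  obtain ⟨F, hF, h0, hinj, hmem, hE⟩ := hP d ⟨hd.1, fun h ↦ hd.2 (hPQ d hd.1 h)⟩
  exact ⟨F, hF, h0, hinj, hmem, fun c hc hc' ↦ hE c hc ⟨hc'.1, fun h ↦ hc'.2 (hPQ _ hc'.1 h)⟩⟩

/-- Local alias of the crux, so that the helper `crux_of_core_of_cert` does not compete with the skeleton theorem
for the by-name audit. -/
abbrev Crux : Prop := HonestFixedRadiusSettling

/-- **CORE + CERT ⇒ CRUX**: on the admissible class, `OneAtlasSettling D → P_G D` pointwise (the MGHD clause is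
shared; for every MGHD, `Cert` turns the one-atlas decomposition into complete `𝓘⁺`, and the honest
decomposition is the crux's `∃ (O, d, R₀)` verbatim — the let-bound `Hc/Hf` of the crux ζ-reduce to
`HonestCore/HonestFar`); genericity is monotone in the property. -/
theorem crux_of_core_of_cert (hG : KerrEndedHonestSettlingGeneric) (hC : Cert) : Crux := by
  intro X _ _ _ _ _ _
  refine isChristodoulouGeneric_mono ?_ (hG X)
  rintro D hD ⟨hex, hall⟩
  refine ⟨hex, fun 𝒟 h𝒟 ↦ ?_⟩
  obtain ⟨O, d, R₀, hO, hc, hf, M, a, r₁, φ, Rs, Bs, κ, hoai⟩ := hall 𝒟 h𝒟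
  exact ⟨hC X D 𝒟 O 4 d M a r₁ φ Rs Bs κ (by norm_num) hoai, O, d, R₀, hO, hc, hf⟩

/-- **THE SKELETON THEOREM** (audited by name): the crux `StarvedNecks.HonestFixedRadiusSettling` from the four
registered stubs. Sorry-free itself; it becomes the crux proof when the stubs land. -/
theorem HonestFixedRadiusSettling_of : HonestFixedRadiusSettling :=
  crux_of_core_of_cert stub_core (cert_of farExit_of_stub entryBookkeeping_of_stub flatZoneSojourn_of_stub)

/-- Wiring check in hypothesis form (an `example`, registers nothing): the four stub STATEMENTS imply the crux. -/
example : KerrEndedHonestSettlingGeneric → FarExit → EntryBookkeeping → FlatZoneSojourn →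
    HonestFixedRadiusSettling :=
  fun hG hA hB hZ ↦ crux_of_core_of_cert hG (cert_of hA hB hZ)

/-! ## §5 The analytic input of the lever, PROVED (ideator 1, `SketchIdeator1b.lean`, re-checked here) -/

/-- `∫₀ᵀ e^{−δt} dt = (1 − e^{−δT})/δ`. -/
lemma integral_exp_neg_mul (δ T : ℝ) (hδ : δ ≠ 0) :
    ∫ t in (0:ℝ)..T, Real.exp (-(δ * t)) = (1 - Real.exp (-(δ * T))) / δ := by
  have h1 : (fun t : ℝ ↦ Real.exp (-(δ * t))) = fun t ↦ Real.exp ((-δ) * t) := by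
    ext t; ring_nf
  rw [h1, intervalIntegral.integral_comp_mul_left (fun x ↦ Real.exp x) (neg_ne_zero.mpr hδ),
    integral_exp]
  simp only [mul_zero, Real.exp_zero, smul_eq_mul]
  field_simp
  ring

/-- One-sided Grönwall: `f' ≤ δ f` on `t ≥ 0` and `f 0 = 1` give `f t ≤ e^{δt}`. -/
lemma le_exp_of_deriv_le (δ : ℝ) (f : ℝ → ℝ) (hf : Differentiable ℝ f) (hf0 : f 0 = 1)
    (hgr : ∀ t, 0 ≤ t → deriv f t ≤ δ * f t) : ∀ t, 0 ≤ t → f t ≤ Real.exp (δ * t) := by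
  set g : ℝ → ℝ := fun t ↦ Real.exp (-(δ * t)) * f t with hg
  have hgd : Differentiable ℝ g := by
    apply Differentiable.mul _ hf
    exact Real.differentiable_exp.comp ((differentiable_const δ).mul differentiable_id).neg
  have hderiv : ∀ t, deriv g t = Real.exp (-(δ * t)) * (deriv f t - δ * f t) := by
    intro t
    have h₁ : HasDerivAt (fun t : ℝ ↦ -(δ * t)) (-δ) t := by
      have h := ((hasDerivAt_id t).const_mul δ).neg
      rw [mul_one] at h
      apply h.congr_of_eventuallyEq
      exact Eventually.of_forall fun y ↦ by simp
    have h₂ : HasDerivAt (fun t : ℝ ↦ Real.exp (-(δ * t))) (Real.exp (-(δ * t)) * (-δ)) t :=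
      (Real.hasDerivAt_exp _).comp t h₁
    have h₃ : HasDerivAt f (deriv f t) t := (hf t).hasDerivAt
    have := h₂.mul h₃
    have h4 : HasDerivAt g (Real.exp (-(δ * t)) * -δ * f t + Real.exp (-(δ * t)) * deriv f t) t := by
      apply this.congr_of_eventuallyEq
      exact Eventually.of_forall fun y ↦ by simp [hg]
    rw [h4.deriv]
    ring
  have hanti : AntitoneOn g (Ici 0) := by
    apply antitoneOn_of_deriv_nonpos (convex_Ici 0) hgd.continuous.continuousOn
      (hgd.differentiableOn.mono interior_subset)
    intro t ht
    rw [interior_Ici] at ht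
    rw [hderiv]
    have := hgr t (le_of_lt ht)
    have hpos : 0 < Real.exp (-(δ * t)) := Real.exp_pos _
    nlinarith
  intro t ht
  have hgt : g t ≤ g 0 := hanti (self_mem_Ici) (mem_Ici.mpr ht) ht
  have hg0 : g 0 = 1 := by simp [hg, hf0]
  rw [hg0] at hgt
  have key : Real.exp (δ * t) * (Real.exp (-(δ * t)) * f t) ≤ Real.exp (δ * t) * 1 :=
    mul_le_mul_of_nonneg_left hgt (Real.exp_pos _).le
  have hexp : Real.exp (δ * t) * Real.exp (-(δ * t)) = 1 := by
    rw [← Real.exp_add]; simp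
  calc f t = Real.exp (δ * t) * Real.exp (-(δ * t)) * f t := by rw [hexp, one_mul]
    _ = Real.exp (δ * t) * (Real.exp (-(δ * t)) * f t) := by ring
    _ ≤ Real.exp (δ * t) * 1 := key
    _ = Real.exp (δ * t) := mul_one _

/-- **Affine sojourn under exponential degradation** (the real-analysis core of `stub_flatZoneSojourn`): if
`f > 0`, `f 0 = 1` and `f' ≤ δ f` on `t ≥ 0` (`δ > 0`), then `∫₀ᵀ dt / f(t) ≥ (1 − e^{−δT})/δ`; with entry rate
`f 0 = L` instead, rescale. Sharp at `f = e^{δt}`: no rate-free improvement exists and none is needed. -/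
theorem affineSojournLowerBound (δ T : ℝ) (hδ : 0 < δ) (hT : 0 ≤ T) (f : ℝ → ℝ) (hf : Differentiable ℝ f)
    (hf0 : f 0 = 1) (hpos : ∀ t, 0 < f t) (hgr : ∀ t, 0 ≤ t → deriv f t ≤ δ * f t) :
    (1 - Real.exp (-(δ * T))) / δ ≤ ∫ t in (0:ℝ)..T, (f t)⁻¹ := by
  have hle : ∀ t ∈ Icc 0 T, Real.exp (-(δ * t)) ≤ (f t)⁻¹ := by
    intro t ht
    have h1 := le_exp_of_deriv_le δ f hf hf0 hgr t ht.1
    have : (Real.exp (δ * t))⁻¹ ≤ (f t)⁻¹ := inv_anti₀ (hpos t) h1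
    simpa [Real.exp_neg] using this
  rw [← integral_exp_neg_mul δ T hδ.ne']
  apply intervalIntegral.integral_mono_on hT ?_ ?_ hle
  · exact (Real.continuous_exp.comp (continuous_const.mul continuous_id).neg).intervalIntegrable _ _
  · apply Continuous.intervalIntegrable
    exact Continuous.inv₀ hf.continuous (fun t ↦ (hpos t).ne')

/-! ## §6 Sanity: the Minkowski end (`M = 0`) has one atlas at infinity with the identity chart -/

/-- For `M = 0` the bent height vanishes identically (`M/√(M² − a²) = 0`). -/
theorem blHeight_zero_mass (a r : ℝ) : blHeight 0 a r = 0 := by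
  simp [blHeight]

/-- For `M = 0` the chart map `blToKS` is the identity. -/
theorem blToKS_zero_mass (a : ℝ) : blToKS 0 a = id := by
  funext y
  simp only [blToKS, blHeight_zero_mass, add_zero, id]
  exact E4.ofTimeSpace_time_spatial y

/-- For `M = 0` the exact end metric in the `(t_BL, x_KS)` chart is the Minkowski form: the EXACT clause of
`OneAtlasAtInfinity` then reads `deviation = 0`, which the identity flat chart of `Disproof.d₀` satisfies — the
`N = 0`, `δ ≡ 0` instance of the line (Disproof §6). -/
theorem kerrBL_zero_mass (a : ℝ) (y : E4) : kerrBL 0 a y = Minkowski.bilin := by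
  simp only [kerrBL, blToKS_zero_mass, Kerr.bilin_zero_left, fderiv_id]
  ext v w
  simp

end Summit.FinalStateConjecture.FinalStateConjecture.Cruxes.HonestFixedRadiusSettling.SojournNeedsOnlyOneOverDelta

end
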